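import Summits.ResolutionOfSingularities.ResolutionOfSingularities.Theorems.MarkedTransferCampaignW36SingularLCIInhabitant
import Summits.ResolutionOfSingularities.ResolutionOfSingularities.Theorems.MarkedTransferCampaignW36EquiInvOnClass
import HarnessLib

/-!
# [OURS · L1 W3.6 ↔ GAP-LEDGER R20 sub 20a ∧ 20b(ii), DNF-HALF BY NAME] AT `p = 2` THE `p`-SLICES OF 20a (`CampaignW36Thm614Part1OnI` / `…R2I`), OF 20b(ii)-loc
# (`CampaignW36EquiInvLocOnI`) AND OF THE REGULAR RESIDUAL (`CampaignW36HatClosureRegularOnI` / `CampaignW36CoreFocusSingRegularOnI`) ALL FAIL ON THE A-TYPE CLASS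
# `LCIClass` — and on every class containing SEAT 1's cross member — while they HOLD on `RegularClosureClass`: SEAT 1's certified inhabitant (p512622) fed through
# the carriers of p508013 / p511607 / p498576

Cell `res-hironaka`, rung L (rescue), row L-G3, slot W3.6 ↔ GAP-LEDGER R20 (res-adj-3's pre-declared trigger (d): «SEAT 1 member certified ⇒
`not_campaignW36Thm614Part1OnI_lciClass_of_singular_closure'` fires ⇒ sub-entry 20a ∧ 20b(ii)|LCIClass∖RegularClosureClass DNF-AS-TYPED at the cross»).
Typed by the OURS typer o4 (statement-only lane; standing offer «F5 Summits-side by name», STATUS 2026-08-27T07:19:44Z (1); res-adj-3 ASK F5b INBOX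
2026-08-27T08:17:35Z — file name and the three `…_lciClass_two` decl names as asked); kernel plumbing only (0 definitions, ≤ 10-line compositions). HOST:
`--supports stmt-ResolutionOfSingularities-16155 --as helper`.

INPUTS BY NAME. SEAT 1 (res-D-pv-034 AS res-L1-s36-pv-3) **p512622** `…Theorems/MarkedTransferCampaignW36SingularLCIInhabitant.lean` (namespace `CrossSpecimenW36`; the
cross specimen `Ê_× = ((z² + x³y³)·𝒪, 2)` on `𝔸³_K`, `K` algebraically closed of characteristic `2`, `Σ̄_max(Ê_×) = C = V(z, xy)`): `exists_isEdgeDataOn_baseHike_EX`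
(a certified R1 family, `n = 3`), `lciClass_baseHike_EX` (`LCIClass Ê_× Σ_max` for EVERY certified `ed`), `not_invmaxClosureRegularOn_baseHike_EX` (`Σ̄_max` NOT
regular), with `CrossSpecimen.isStandard_EX`, `CrossSpecimen.baseHike_b_pos`, `SpecimenA.ambient K 2`. CARRIERS: p508013
`not_campaignW36Thm614Part1OnI_of_singular_closure'` (20a, both readings), p511607 `not_campaignW36EquiInvLocOnI_of_singular_closure` (20b(ii)-loc), and the
definitions of p498576 (`CampaignW36HatClosureRegularOnI`, `campaignW36CoreFocusSingRegularOnI_iff`).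
* §1 at a given algebraically closed `K` of characteristic `2` (universe `0`, where the specimen lives): `not_slices_two_of_mem 𝒞 (ed) (hed) (hC)` — for EVERY
  class `𝒞` containing the member `(Ê_×, ed)`: `¬ Thm614Part1OnI 𝒞 2 ∧ ¬ Thm614Part1OnR2I 𝒞 2 ∧ ¬ EquiInvLocOnI 𝒞 2 ∧ ¬ HatClosureRegularOnI 𝒞 2 ∧
  ¬ CoreFocusSingRegularOnI 𝒞 2`; instances `not_slices_two_lciClass_of K`, `not_slices_two_lciOrMonomialClass_of K`.
* §2 UNCONDITIONAL (`K := \overline{𝔽_2}`): **`not_campaignW36_slices_lciClass_two`** and its asked projections **`not_campaignW36EquiInvLocOnI_lciClass_two`**,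
  **`not_campaignW36Thm614Part1OnI_lciClass_two`**, **`not_campaignW36Thm614Part1OnR2I_lciClass_two`** (res-adj-3 F5b (1)–(3)), `not_campaignW36_slices_lciOrMonomialClass_two`;
  CONTRAST `campaignW36_slices_regularClosureClass_two` (all five ✓ on `RegularClosureClass` at `p = 2`, p498576 / p501108 / p511607). The optional rider (c1)
  `¬ S15ARSchemes.U75L37` at the member is NOT in this file.
NET FOR THE WORD (res-adj-3's to say): at `p = 2`, ON `LCIClass` (⊋ `RegularClosureClass`) and on the door's class `LCIOrMonomialClass`, 20a (R1 and R2 slices) ∧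
20b(ii)-loc ∧ ⟨HatClosureRegular⟩ ∧ «`Ě` exists with regular `Sing(Ě)`» are ALL REFUTED AS CLASS HYPOTHESES, BY NAME, by ONE certified member; on `RegularClosureClass`
all hold. Nothing here says anything about other primes or about the manuscript's sentences as printed.

HONEST FRAMING. Kernel plumbing over OUR typed class Props and SEAT 1's certified specimen; NOTHING here is a statement of H. Hironaka's manuscript (2017-03-23,
[Hironaka2017], lit key `paper:url-3343fd9e678b`), which stays «under review»; the refuted objects are OURS class-level HYPOTHESIS rows (res-adj-3 04:12:28Z: never
moduli of record), not printed statements. AI typing, weaker than expert review.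
Reference (context only, not a premise): H. Hironaka, ms. 2017-03-23, §6.2 Eq. (43) p.30; §6.3 Th. 6.14 (1) p.34; Eq. (125) p.78. [Hironaka2017]
-/

noncomputable section

set_option linter.dupNamespace false -- mandated namespace of this single-conjunct summit

open _root_.AlgebraicGeometry _root_.TopologicalSpace
namespace Summit.ResolutionOfSingularities.ResolutionOfSingularities.Theorems

open Literature.AlgebraicGeometry.Resolution Literature.AlgebraicGeometry.Hironaka2017
open Literature.AlgebraicGeometry.Hironaka2017.S02Preliminaries Literature.AlgebraicGeometry.Hironaka2017.S04CharAlgebra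
open Literature.AlgebraicGeometry.Hironaka2017.S06BaseHike Literature.AlgebraicGeometry.Hironaka2017.Datum
open Literature.AlgebraicGeometry.Hironaka2017.S06BaseHike.SpecimenA (ambient)
open Literature.AlgebraicGeometry.Hironaka2017.S06BaseHike.CrossSpecimen (EX isStandard_EX baseHike_b_pos)
open Scheme.IdealSheafData IsLocalRing CampaignW36

namespace CrossSpecimenW36

/-! ## §1 At a given algebraically closed field of characteristic 2 -/
section AtField

variable (K : Type) [Field K] [CharP K 2] [IsAlgClosed K]

/-- **ONE MEMBER KILLS ALL FIVE `p = 2` SLICES ON EVERY CLASS CONTAINING IT.** For every class `𝒞` (universe `0`) containing the cross member `(Ê_×, ed)` (`ed` any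
certified R1 family of `Ê_×`): 20a in both readings, 20b(ii)-loc, the regular residual and «`Ě` exists with regular `Sing(Ě)`» all FAIL as class hypotheses at `p = 2`
(carriers p508013 / p511607; p498576's definitions; SEAT 1's p512622 `lciClass_baseHike_EX` / `not_invmaxClosureRegularOn_baseHike_EX`). Kernel plumbing; NOT a
statement of the manuscript. [folklore] -/
theorem not_slices_two_of_mem (𝒞 : ∀ ⦃W : Scheme.{0}⦄, IdealExponent W → Set W → Prop) {n : ℕ} (ed : EdgeDataOn 2 n (baseHike (EX K)))
    (hed : IsEdgeDataOn CampaignW31.edgeDataProvenance (baseHike (EX K)) ed)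
    (hC : 𝒞 (baseHike (EX K))
      (invmaxStratum ((baseHike (EX K)).sing ∩ S02Preliminaries.closedPoints (SpecimenA.Z K)) (invField (baseHike (EX K)) ed))) :
    ¬ CampaignW36Thm614Part1OnI.{0} 𝒞 2 ∧ ¬ CampaignW36Thm614Part1OnR2I.{0} 𝒞 2 ∧ ¬ CampaignW36EquiInvLocOnI.{0} 𝒞 2 ∧
      ¬ CampaignW36HatClosureRegularOnI.{0} 𝒞 2 ∧ ¬ CampaignW36CoreFocusSingRegularOnI.{0} 𝒞 2 := by
  have hlci := lciClass_baseHike_EX K ed hed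
  have hsing := not_invmaxClosureRegularOn_baseHike_EX K ed hed
  have h20a := not_campaignW36Thm614Part1OnI_of_singular_closure' 𝒞 2 K (ambient K 2) n (EX K) ed (isStandard_EX K)
    (baseHike_b_pos K) hed hC (lciClass_le _ _ hlci) hsing
  have hhat : ¬ CampaignW36HatClosureRegularOnI.{0} 𝒞 2 := fun h =>
    hsing (h K (ambient K 2) n (EX K) ed (isStandard_EX K) (baseHike_b_pos K) hed hC)
  exact ⟨h20a.1, h20a.2,
    not_campaignW36EquiInvLocOnI_of_singular_closure 𝒞 2 K (ambient K 2) n (EX K) ed (isStandard_EX K) (baseHike_b_pos K) hed hC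
      (lciClass_le _ _ hlci) hsing,
    hhat, fun h => hhat ((campaignW36CoreFocusSingRegularOnI_iff 𝒞 2).mp h)⟩

end AtField

/-- **On the A-type class `LCIClass`** (given an algebraically closed `K` of characteristic `2` to host the member): all five `p = 2` slices fail. Kernel
plumbing; NOT a statement of the manuscript. [folklore] -/
theorem not_slices_two_lciClass_of (K : Type) [Field K] [CharP K 2] [IsAlgClosed K] :
    ¬ CampaignW36Thm614Part1OnI.{0} LCIClass 2 ∧ ¬ CampaignW36Thm614Part1OnR2I.{0} LCIClass 2 ∧ ¬ CampaignW36EquiInvLocOnI.{0} LCIClass 2 ∧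
      ¬ CampaignW36HatClosureRegularOnI.{0} LCIClass 2 ∧ ¬ CampaignW36CoreFocusSingRegularOnI.{0} LCIClass 2 := by
  obtain ⟨ed, hed⟩ := exists_isEdgeDataOn_baseHike_EX K
  exact not_slices_two_of_mem K LCIClass ed hed (lciClass_baseHike_EX K ed hed)

/-- **On the W3.6 door's class `LCIOrMonomialClass`** (given such a `K`): all five `p = 2` slices fail. Kernel plumbing; NOT a statement of the manuscript.
[folklore] -/
theorem not_slices_two_lciOrMonomialClass_of (K : Type) [Field K] [CharP K 2] [IsAlgClosed K] :
    ¬ CampaignW36Thm614Part1OnI.{0} LCIOrMonomialClass 2 ∧ ¬ CampaignW36Thm614Part1OnR2I.{0} LCIOrMonomialClass 2 ∧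
      ¬ CampaignW36EquiInvLocOnI.{0} LCIOrMonomialClass 2 ∧ ¬ CampaignW36HatClosureRegularOnI.{0} LCIOrMonomialClass 2 ∧
      ¬ CampaignW36CoreFocusSingRegularOnI.{0} LCIOrMonomialClass 2 := by
  obtain ⟨ed, hed⟩ := exists_isEdgeDataOn_baseHike_EX K
  exact not_slices_two_of_mem K LCIOrMonomialClass ed hed (lciClass_le _ _ (lciClass_baseHike_EX K ed hed))

/-! ## §2 Unconditional (`K := \overline{𝔽_2}`) and the contrast on `RegularClosureClass` -/

/-- **20a (R1, R2) ∧ 20b(ii)-loc ∧ ⟨HatClosureRegular⟩ ∧ «`Ě` exists with regular `Sing(Ě)`» ALL FAIL ON `LCIClass` AT `p = 2`, UNCONDITIONALLY** (witness field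
`\overline{𝔽_2}`; member = SEAT 1's cross specimen p512622). The DNF-half of res-adj-3's sub-entry «20a ∧ 20b(ii)|LCIClass∖RegularClosureClass», BY NAME. Kernel
plumbing; NOT a statement of the manuscript. [folklore] -/
theorem not_campaignW36_slices_lciClass_two :
    ¬ CampaignW36Thm614Part1OnI.{0} LCIClass 2 ∧ ¬ CampaignW36Thm614Part1OnR2I.{0} LCIClass 2 ∧ ¬ CampaignW36EquiInvLocOnI.{0} LCIClass 2 ∧
      ¬ CampaignW36HatClosureRegularOnI.{0} LCIClass 2 ∧ ¬ CampaignW36CoreFocusSingRegularOnI.{0} LCIClass 2 :=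
  not_slices_two_lciClass_of (AlgebraicClosure (ZMod 2))

/-- **F5b (1): `¬ CampaignW36EquiInvLocOnI LCIClass 2`** — 20b(ii)-loc DOES-NOT-FOLLOW-AS-TYPED on the A-type class at `p = 2` (p511607 ∘ p512622). Kernel plumbing;
NOT a statement of the manuscript. [folklore] -/
theorem not_campaignW36EquiInvLocOnI_lciClass_two : ¬ CampaignW36EquiInvLocOnI.{0} LCIClass 2 :=
  not_campaignW36_slices_lciClass_two.2.2.1

/-- **F5b (2): `¬ CampaignW36Thm614Part1OnI LCIClass 2`** — 20a (reading R1 of the produced data) DOES-NOT-FOLLOW-AS-TYPED on the A-type class at `p = 2`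
(p508013 ∘ p512622). Kernel plumbing; NOT a statement of the manuscript. [folklore] -/
theorem not_campaignW36Thm614Part1OnI_lciClass_two : ¬ CampaignW36Thm614Part1OnI.{0} LCIClass 2 :=
  not_campaignW36_slices_lciClass_two.1

/-- **F5b (3): `¬ CampaignW36Thm614Part1OnR2I LCIClass 2`** — 20a (reading R2 of the produced data) DOES-NOT-FOLLOW-AS-TYPED on the A-type class at `p = 2`
(p508013 ∘ p512622). Kernel plumbing; NOT a statement of the manuscript. [folklore] -/
theorem not_campaignW36Thm614Part1OnR2I_lciClass_two : ¬ CampaignW36Thm614Part1OnR2I.{0} LCIClass 2 :=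
  not_campaignW36_slices_lciClass_two.2.1

/-- **… and ON THE DOOR'S CLASS `LCIOrMonomialClass` AT `p = 2`, UNCONDITIONALLY.** Kernel plumbing; NOT a statement of the manuscript. [folklore] -/
theorem not_campaignW36_slices_lciOrMonomialClass_two :
    ¬ CampaignW36Thm614Part1OnI.{0} LCIOrMonomialClass 2 ∧ ¬ CampaignW36Thm614Part1OnR2I.{0} LCIOrMonomialClass 2 ∧
      ¬ CampaignW36EquiInvLocOnI.{0} LCIOrMonomialClass 2 ∧ ¬ CampaignW36HatClosureRegularOnI.{0} LCIOrMonomialClass 2 ∧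
      ¬ CampaignW36CoreFocusSingRegularOnI.{0} LCIOrMonomialClass 2 :=
  not_slices_two_lciOrMonomialClass_of (AlgebraicClosure (ZMod 2))

/-- **CONTRAST: on `RegularClosureClass` all five `p = 2` slices HOLD** (p501108 `campaignW36Thm614Part1OnI_regularClosure_holds` / `…R2I…`, p511607
`campaignW36EquiInvLocOnI_regularClosure_holds`, p498576 `campaignW36HatClosureRegularOnI_regularClosure_holds` / `campaignW36CoreFocusSingRegularOnI_regularClosure_holds`)
— so the failure locus is `LCIClass ∖ RegularClosureClass`, where the cross lives. Kernel plumbing; NOT a statement of the manuscript. [folklore] -/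
theorem campaignW36_slices_regularClosureClass_two :
    CampaignW36Thm614Part1OnI.{0} RegularClosureClass 2 ∧ CampaignW36Thm614Part1OnR2I.{0} RegularClosureClass 2 ∧
      CampaignW36EquiInvLocOnI.{0} RegularClosureClass 2 ∧ CampaignW36HatClosureRegularOnI.{0} RegularClosureClass 2 ∧
      CampaignW36CoreFocusSingRegularOnI.{0} RegularClosureClass 2 :=
  ⟨campaignW36Thm614Part1OnI_regularClosure_holds 2, campaignW36Thm614Part1OnR2I_regularClosure_holds 2,
    campaignW36EquiInvLocOnI_regularClosure_holds 2, campaignW36HatClosureRegularOnI_regularClosure_holds 2,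
    campaignW36CoreFocusSingRegularOnI_regularClosure_holds 2⟩

end CrossSpecimenW36

end Summit.ResolutionOfSingularities.ResolutionOfSingularities.Theorems

end
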